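/-
Origin: expansion seat `planner-pub-hodgecm-mc-sanity-1-g2-0`, handover #4 2026-08-18T21:36Z md5 46799a7e19afc022eb0a58b092077c31 (NEW, 195 l., 9 decls; rc 0 / 6 s / 0 warnings / 0 proof-hole-adm-token tokens / #print axioms 5/5 = propext+Classical.choice+Quot.sound; imports HodgeCM.Model.SupplyResidual (= theta-3-g2 t33-mctheta3g2 T3 #2, src d1c5decd32a8 / as-installed twin-import version) + HodgeCM.Model.Sanity.SupplySanity (this kit #2); INSTALL AFTER both; no import rewrit (`HOME/mc/pub-hodgecm-mc-sanity-1-g2/lean/SupplyPairSanity.lean`, md5 46799a7e, 195 lines);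
landed by the packager successor (mc-unitary-1-g3, gen-8 kit) in gate run 32 as `HodgeCM/Model/Sanity/SupplyPairSanity.lean` (stripped 5 #print/#check/#eval lines).
-/
import Summits.HodgeConjecture.HodgeCM.Model.SupplyResidual
import Summits.HodgeConjecture.HodgeCM.Model.Sanity.SupplySanity

/-
Copyright: pub-hodgecm MODEL-CONSTRUCTION cell, 2026-08-18. Seat planner-pub-hodgecm-mc-sanity-1-g2-0 (node SAN-4 (c⁺):
degenerate-instance sanity of the PAIR-level supply instance, OFF the E path). KERNEL ONLY: 0 records cited,
0 hypotheses minted, 0 proof holes.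

# Sanity rows for `WeilPairData` / `PairSupplyData` (theta-3-g2 `Model/SupplyResidual.lean`, md5 d1c5decd32a8)

Intended install path `HodgeCM/Model/Sanity/SupplyPairSanity.lean` (additive leaf; imports the file it tests and
the line-level sanity file `Sanity/SupplySanity.lean`, whose trivial datum it reuses).

QUESTION (payload SAN duty, one level up from `SupplySanity`): the pair record `WeilPairData K L J GU` states
the two Weil hypotheses for the whole PAIR action `ω` of `G_U(𝔸) × U(W_j)(𝔸)` — (W-maj⁺) `majorants`,
(W-rat⁺) `theta_rat` for `Γ_U × U(W_j)(L₀)` — plus an arithmetic subgroup `Γ_U`, and phrases the residual in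
TREE vocabulary, (W-resT) `ResidualT` (`ThetaKernelDatum.thetaLiftFun … 1 ≠ 0 ⇒ ∃ Γ, ∃ ω ∈ Θ_k(Γ), ω ≠ 0`).
Which of these carry content for the output of `WeilPairData.supply` / `open_supply_of_pairSupplyData`?

ANSWER (kernel-checked):
* (W-resT) ⟺ (W-res) for EVERY pair datum (`residualT_iff_residual`; the owner proves `⇒`, the converse
  is the same junction lemma `integral_kernelBar_mul_char_eq_thetaLiftFun` read backwards) — the change of
  vocabulary neither adds nor removes content.
* `trivialPairData Φ_∞ x₀ hx₀ : WeilPairData K L J GU` — trivial pair action `ω := 1`, `Γ_U := ⊤`, weight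
  `w := 1`, over ANY `L/K`, `J`, topological group `GU`: (W-wt), (W-maj⁺), (W-rat⁺) hold by one-liners, and its
  line restriction IS the trivial line datum (`trivialPairData_toLineData`, `rfl`); `[G_U] = GU ⧸ ⊤` is a point,
  so the compactness instance the tree lift needs is free (`compactSpace_quotient_top`).
* Hence (W-resT) at the trivial pair datum is the target guarded by one theta constant
  (`residualT_trivialPairData_iff`), `PairSupplyData T V c k` is inhabited from its own conclusion over
  `L := K`, `GU := Unit` (`pairSupplyData_of_supply`), and
  `Nonempty (PairSupplyData T V c k) ↔ ∃ Γ, ∃ ω ∈ T.Theta V c k Γ, ω ≠ 0` (`nonempty_pairSupplyData_iff`);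
  the hypothesis of `open_supply_of_pairSupplyData` is `T.Open_supply` read pointwise
  (`pairSupplyData_hypothesis_iff`).
So at pair level too the ONLY content-carrying field is the residual: every Weil-side field of the record
(`ω`, `Γ_U`, `w`, (W-wt), (W-maj⁺), (W-rat⁺)) is discharged by the trivial action.  This is a statement about
the RECORD AS TYPED, not about Weil's theorem: the honest datum (theta-2-g2's `𝒮(𝔸_K^J)` Weil representation)
makes (W-resT) a genuine analytic statement; the record just does not force anyone to supply it.
-/

set_option autoImplicit false

noncomputable section

open MeasureTheory NumberField NumberField.mixedEmbedding
open Literature.NumberTheory.Automorphic Literature.NumberTheory.Weil1964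
open HodgeCM.PerL34.SupplyAdelic HodgeCM.Model.SupplyInstance
open scoped SchwartzMap Classical

namespace HodgeCM
namespace Model
namespace SupplyResidual

/-! ### § 1. (W-resT) ⟺ (W-res) for every pair datum -/

section General

variable {K L : Type} [Field K] [NumberField K] [Field L] [NumberField L] [Algebra K L] [FiniteDimensional K L]
variable {J : Type} [Fintype J] {GU : Type} [Group GU] [TopologicalSpace GU] [IsTopologicalGroup GU]
  [LocallyCompactSpace GU] (P : WeilPairData K L J GU) [CompactSpace (GU ⧸ P.ΓU)]
variable {U : Universe} (T : U.ThetaModel) {Lc : CMField} {ι₁ : Lc →+* ℂ} (V : HermSpace3 Lc ι₁) (c : SeesawCtx Lc)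
  (k : Fin 4)

/-- **(W-resT) ⟺ (W-res)**: the residual in tree vocabulary is equivalent to the residual in package vocabulary
of the restricted line datum (the junction `∫ θ̄_N χ dν = Θ̃_{φ_N}(χ⁻)(1)` read in both directions). -/
theorem residualT_iff_residual : P.ResidualT T V c k ↔ P.toLineData.Residual T V c k := by
  refine ⟨fun h => P.residual_of_residualT h, fun h N χ hN htype hne => h N χ hN htype ?_⟩
  rwa [WeilPairData.integral_kernelBar_mul_char_eq_thetaLiftFun]

end General

/-! ### § 2. The trivial pair datum -/

section Trivial

variable {K L : Type} [Field K] [NumberField K] [Field L] [NumberField L] [Algebra K L] [FiniteDimensional K L]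
variable {J : Type} [Fintype J] {GU : Type} [Group GU] [TopologicalSpace GU]

attribute [local instance] ratModule

variable (K L J GU) in
/-- **The trivial pair datum**: trivial pair action, `Γ_U := ⊤`, weight `1`, any archimedean test function
non-vanishing at a rational point.  (W-wt), (W-maj⁺), (W-rat⁺) are discharged by one-liners. -/
@[reducible] def trivialPairData (Φinf : 𝓢((J → mixedSpace K), ℂ)) (x₀ : J → K)
    (hx₀ : Φinf (archEmb K J x₀) ≠ 0) : WeilPairData K L J GU where
  ΓU := ⊤
  ω := 1
  Φinf := Φinf
  x₀ := x₀
  hx₀ := hx₀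
  w _ := 1
  weight N t := by rw [MonoidHom.one_apply, Module.End.one_apply, one_smul]
  majorants :=
    ⟨fun Φ ξ => by simpa only [MonoidHom.one_apply, Module.End.one_apply] using continuous_const,
     fun Φ g₀ => ⟨Set.univ, Filter.univ_mem, fun ξ => ‖(Φ : (J → AdeleRing (𝓞 K) K) → ℂ) (ratPt K J ξ)‖,
       summable_norm_ratPt Φ.2, fun ξ g _ => by rw [MonoidHom.one_apply, Module.End.one_apply]⟩⟩
  theta_rat _ _ _ _ := by rw [MonoidHom.one_apply]; exact Submonoid.one_mem _

variable (Φinf : 𝓢((J → mixedSpace K), ℂ)) (x₀ : J → K) (hx₀ : Φinf (archEmb K J x₀) ≠ 0)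

/-- Its restriction to the line is the trivial line datum of `Sanity/SupplySanity`. -/
theorem trivialPairData_toLineData [ContinuousMul GU] :
    (trivialPairData K L J GU Φinf x₀ hx₀).toLineData = trivialLineData K L J GU Φinf x₀ hx₀ := rfl

/-- `[G_U] = G_U(𝔸) ⧸ ⊤` is one point, hence compact: the instance the tree lift needs, for free. -/
theorem compactSpace_quotient_top : CompactSpace (GU ⧸ (⊤ : Subgroup GU)) := Finite.compactSpace

variable [IsTopologicalGroup GU] [LocallyCompactSpace GU]
variable {U : Universe} (T : U.ThetaModel) {Lc : CMField} {ι₁ : Lc →+* ℂ} (V : HermSpace3 Lc ι₁) (c : SeesawCtx Lc)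
  (k : Fin 4)

/-- The tree lift of the trivial pair datum against `χ⁻` is `Θ(φ_N) · ∫ χ dν`. -/
theorem thetaLiftFun_trivialPairData (N : ℕ) (χ : PontryaginDual (relNormOneIdeles K L ⧸ relNormOneRat K L)) :
    (trivialPairData K L J GU Φinf x₀ hx₀).kernelDatum.thetaLiftFun (probHaarRelNormOneQuot K L)
        ((trivialPairData K L J GU Φinf x₀ hx₀).testFunT N) (WeilPairData.charInv χ) 1 =
      thetaDistLM K J (testFun K J Φinf x₀ N) * ∫ q, ((χ q : Circle) : ℂ) ∂(probHaarRelNormOneQuot K L) := by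
  rw [← WeilPairData.integral_kernelBar_mul_char_eq_thetaLiftFun, trivialPairData_toLineData,
    trivialLineData_lift]

/-- **(W-resT) at the trivial pair datum IS the target, guarded by one theta constant.** -/
theorem residualT_trivialPairData_iff :
    (trivialPairData K L J GU Φinf x₀ hx₀).ResidualT T V c k ↔
      ((∃ N : ℕ, 0 < N ∧ thetaDistLM K J (testFun K J Φinf x₀ N) ≠ 0) →
        ∃ Γ : Level V, ∃ ω ∈ T.Theta V c k Γ, ω ≠ 0) := by
  rw [residualT_iff_residual, trivialPairData_toLineData]
  exact residual_trivialLineData_iff Φinf x₀ hx₀ T V c k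

end Trivial

/-! ### § 3. The pair supply record from its own conclusion -/

section Record

variable {K : Type} [Field K] [NumberField K] {J : Type} [Fintype J]
variable {U : Universe} (T : U.ThetaModel) {Lc : CMField} {ι₁ : Lc →+* ℂ} (V : HermSpace3 Lc ι₁) (c : SeesawCtx Lc)
  (k : Fin 4)

/-- **`PairSupplyData` from its own conclusion**: the trivial pair datum over `L := K`, `G_U := Unit` inhabits the
pair supply record for type index `k` as soon as a non-zero theta one-form of type index `k` exists. -/
def pairSupplyData_of_supply (Φinf : 𝓢((J → mixedSpace K), ℂ)) (x₀ : J → K) (hx₀ : Φinf (archEmb K J x₀) ≠ 0)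
    (hΘ : ∃ Γ : Level V, ∃ ω ∈ T.Theta V c k Γ, ω ≠ 0) : PairSupplyData T V c k where
  K := K
  L := K
  J := J
  GU := Unit
  instK := inferInstance
  instKnf := inferInstance
  instL := inferInstance
  instLnf := inferInstance
  instAlg := inferInstance
  instFD := inferInstance
  instJ := inferInstance
  instGU := inferInstance
  instGUtop := inferInstance
  instGUtg := inferInstance
  instGUlc := inferInstance
  P := trivialPairData K K J Unit Φinf x₀ hx₀
  instCompact := compactSpace_quotient_top
  res := (residualT_trivialPairData_iff Φinf x₀ hx₀ T V c k).mpr fun _ => hΘ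

/-- **The pair supply record is exactly as strong as its output**:
`Nonempty (PairSupplyData T V c k) ↔ ∃ Γ, ∃ ω ∈ Θ_k(Γ), ω ≠ 0`
(`→` is the owner's supply theorem, `←` the trivial pair datum). -/
theorem nonempty_pairSupplyData_iff (Φinf : 𝓢((J → mixedSpace K), ℂ)) (x₀ : J → K)
    (hx₀ : Φinf (archEmb K J x₀) ≠ 0) :
    Nonempty (PairSupplyData T V c k) ↔ ∃ Γ : Level V, ∃ ω ∈ T.Theta V c k Γ, ω ≠ 0 :=
  ⟨fun ⟨S⟩ => S.toLineSupplyData.D.supply S.toLineSupplyData.res,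
    fun hΘ => ⟨pairSupplyData_of_supply T V c k Φinf x₀ hx₀ hΘ⟩⟩

/-- The hypothesis of `open_supply_of_pairSupplyData` is `T.Open_supply` read pointwise. -/
theorem pairSupplyData_hypothesis_iff (Φinf : 𝓢((J → mixedSpace K), ℂ)) (x₀ : J → K)
    (hx₀ : Φinf (archEmb K J x₀) ≠ 0) :
    (∀ {Lc : CMField} {ι₁ : Lc →+* ℂ} (V : HermSpace3 Lc ι₁) (c : SeesawCtx Lc), T.GoodCtx ι₁ c →
        Nonempty (PairSupplyData T V c 0) ∧ Nonempty (PairSupplyData T V c 1)) ↔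
      ∀ {Lc : CMField} {ι₁ : Lc →+* ℂ} (V : HermSpace3 Lc ι₁) (c : SeesawCtx Lc), T.GoodCtx ι₁ c →
        (∃ Γ : Level V, ∃ ω ∈ T.Theta V c 0 Γ, ω ≠ 0) ∧ ∃ Γ : Level V, ∃ ω ∈ T.Theta V c 1 Γ, ω ≠ 0 := by
  refine ⟨fun H Lc ι₁ V c hc => ?_, fun H Lc ι₁ V c hc => ?_⟩
  · exact ⟨(nonempty_pairSupplyData_iff T V c 0 Φinf x₀ hx₀).mp (H V c hc).1,
      (nonempty_pairSupplyData_iff T V c 1 Φinf x₀ hx₀).mp (H V c hc).2⟩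
  · exact ⟨(nonempty_pairSupplyData_iff T V c 0 Φinf x₀ hx₀).mpr (H V c hc).1,
      (nonempty_pairSupplyData_iff T V c 1 Φinf x₀ hx₀).mpr (H V c hc).2⟩

end Record

end SupplyResidual
end Model
end HodgeCM

end

/-! ## Axiom audit (expected: `propext`, `Classical.choice`, `Quot.sound` only) -/
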